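import Mathlib
import HarnessLib
import Literature.Analysis.FluidPDE.TypeIAncientMild
import Summits.NavierStokesRegularity.NavierStokesRegularity.Theses.ExtremalTypeIConstant
import Summits.NavierStokesRegularity.NavierStokesRegularity.Theorems.ExtremalTypeIConstantMinimiserExists
import Summits.NavierStokesRegularity.NavierStokesRegularity.Theorems.ExtremalTypeIConstantExtremalSpiralSymmetryRouteIdentity

/-!
# Crux `ExtremalSpiralSymmetry` (stmt-NavierStokesRegularity-8215), line `registered` — the WEAKEST SUFFICIENT
# form of crux 2: "a nontrivial Type-I ancient element forces a Type-I scaling soliton"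

Support file (theorems only, `--supports stmt-NavierStokesRegularity-8215`; no definitions, no named facts). Lead c5.

Write `X = TypeIAncientLiouville` (route target, stmt-4050), `ESS = ExtremalSpiralSymmetry` (this crux: EVERY extremal
pair carries a spiral-scaling generator), `SSL = SpiralScalingLiouville` (crux 3, stmt-8216) and `A_C = IsTypeIAncientMild C`
(the class, `isTypeIAncientMild_iff`). The route's assembly consumes the symmetry of ONE extremal only
(`TargetOfCruxes`: a nontrivial element ↦ an extremal (`MinimiserExists`, proved) ↦ its generator (ESS) ↦ `SSL` kills it).
Hence the universally quantified crux can be replaced by the bare existence statement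

  `SYM∃`: if some `A_C` has a nontrivial element, then some `A_{C'}` has a NONTRIVIAL element invariant under a
  one-parameter spiral-scaling group (generator `∇w·(a + x + Ax) + w + 2t ∂ₜw − Aw ≡ 0`, `A` skew) — i.e. a bounded-profile
  backward (rotated) self-similar Type-I ancient mild solution, a SCALING SOLITON of the class, exists —

without losing the target, and `SYM∃` is the weakest statement with this property: it is literally the part of `X` that
`SSL` does not cover. Kernel-checked here, by pure logic over landed theorems:

* `typeIAncientLiouville_of_existsSymmetricElement_of_spiralScalingLiouville` — `SYM∃ → SSL → X` (no `MinimiserExists`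
  needed);
* `existsSymmetricElement_of_typeIAncientLiouville` — `X → SYM∃` (vacuous);
* `typeIAncientLiouville_iff_existsSymmetricElement_and_spiralScalingLiouville` — **`X ↔ (SYM∃ ∧ SSL)`**, unconditional;
* `existsSymmetricElement_iff_typeIAncientLiouville_of_spiralScalingLiouville` — `SSL → (SYM∃ ↔ X)`;
* `existsSymmetricElement_of_extremalSpiralSymmetry` — `ESS → SYM∃` (through the proved `MinimiserExists`: the symmetric
  element may be taken EXTREMAL, `‖w(−1,0)‖ = C⋆ > 0` with `C⋆` the least constant of a nontrivial element);
* `extremalSpiralSymmetry_iff_existsSymmetricElement_of_spiralScalingLiouville` — `SSL → (ESS ↔ SYM∃)`.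

Reading for the planner / ideation. Modulo crux 3 the statements `ESS` (∀ extremal), "some extremal is symmetric" and
`SYM∃` are all equivalent to `X` (this file and `…RouteIdentity.lean`, p161077); they differ only as PROOF TARGETS.
`ESS` additionally asserts that NO extremal is asymmetric — in particular that no extremal is heteroclinic under
blow-down (an extremal whose blow-down limits leave its similarity orbit cannot be rotated-self-similar, since the
blow-downs `λu(λ²t, λx)` of an RSS field are rotations of it) — a rigidity that the assembly never uses and that no
isolation/finiteness mechanism of Conjecture-M type can deliver (such mechanisms act on blow-down-MINIMAL extremals
only; cf. `exists_selfRecurrent_extremal`, p155788). If crux 2 is kept in symmetric form it should be filed as `SYM∃`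
(or "some extremal of `A_{C⋆}` is a scaling soliton"); nothing here asserts `X`, `ESS`, `SSL` or `SYM∃`.
-/

noncomputable section

-- the summit and its single sub-problem share the name (CONVENTIONS §1), as in every Theorems file
set_option linter.dupNamespace false

open Set MeasureTheory Filter Topology
open Literature.Analysis.FluidPDE

namespace Summit.NavierStokesRegularity.NavierStokesRegularity.Theorems.ExtremalSpiralSymmetry.Registered

open _root_.Summit.NavierStokesRegularity.NavierStokesRegularity.Theses.ExtremalTypeIConstant
open _root_.Summit.NavierStokesRegularity.NavierStokesRegularity.Theorems

/-- **`SYM∃ ∧ SSL ⇒ X`.** If every nontrivial Type-I ancient element forces a nontrivial scaling soliton of the class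
(`SYM∃`, first hypothesis, displayed) and scaling solitons of the class vanish (`SpiralScalingLiouville`), then every
element of every `A_C` vanishes. Pure logic; `MinimiserExists` is not used. [folklore: pure logic] -/
theorem typeIAncientLiouville_of_existsSymmetricElement_of_spiralScalingLiouville
    (hSym : ∀ (C : ℝ) (u : ℝ → EuclideanSpace ℝ (Fin 3) → EuclideanSpace ℝ (Fin 3)),
      IsTypeIAncientMild C u → (∃ t < 0, ∃ x, u t x ≠ 0) →
        ∃ (C' : ℝ) (w : ℝ → EuclideanSpace ℝ (Fin 3) → EuclideanSpace ℝ (Fin 3)),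
          IsTypeIAncientMild C' w ∧ (∃ t < 0, ∃ x, w t x ≠ 0) ∧
            ∃ (a : EuclideanSpace ℝ (Fin 3)) (A : EuclideanSpace ℝ (Fin 3) →L[ℝ] EuclideanSpace ℝ (Fin 3)),
              (∀ x, inner ℝ (A x) x = 0) ∧
                ∀ t < 0, ∀ x, fderiv ℝ (w t) x (a + x + A x) + w t x +
                  (2 * t) • Literature.Analysis.FluidPDE.timeDeriv w t x - A (w t x) = 0)
    (hSSL : SpiralScalingLiouville) : TypeIAncientLiouville := by
  intro C u hu t ht x
  by_contra hne
  obtain ⟨C', w, hw, ⟨t', ht', x', hne'⟩, a, A, hA, hgen⟩ :=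
    hSym C u (isTypeIAncientMild_iff.2 hu) ⟨t, ht, x, hne⟩
  exact hne' (hSSL C' w (isTypeIAncientMild_iff.1 hw) ⟨a, A, hA, hgen⟩ t' ht' x')

/-- **`X ⇒ SYM∃`, vacuously**: under the target no `A_C` has a nontrivial element. [folklore: pure logic] -/
theorem existsSymmetricElement_of_typeIAncientLiouville (hX : TypeIAncientLiouville) :
    ∀ (C : ℝ) (u : ℝ → EuclideanSpace ℝ (Fin 3) → EuclideanSpace ℝ (Fin 3)),
      IsTypeIAncientMild C u → (∃ t < 0, ∃ x, u t x ≠ 0) →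
        ∃ (C' : ℝ) (w : ℝ → EuclideanSpace ℝ (Fin 3) → EuclideanSpace ℝ (Fin 3)),
          IsTypeIAncientMild C' w ∧ (∃ t < 0, ∃ x, w t x ≠ 0) ∧
            ∃ (a : EuclideanSpace ℝ (Fin 3)) (A : EuclideanSpace ℝ (Fin 3) →L[ℝ] EuclideanSpace ℝ (Fin 3)),
              (∀ x, inner ℝ (A x) x = 0) ∧
                ∀ t < 0, ∀ x, fderiv ℝ (w t) x (a + x + A x) + w t x +
                  (2 * t) • Literature.Analysis.FluidPDE.timeDeriv w t x - A (w t x) = 0 := by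
  intro C u hu hne
  exfalso
  obtain ⟨t, ht, x, h⟩ := hne
  exact h (hX C u (isTypeIAncientMild_iff.1 hu) t ht x)

/-- **Route identity in weakest form: `X ↔ (SYM∃ ∧ SSL)`.** The target is equivalent to the conjunction of crux 3 and
the bare existence statement "a nontrivial Type-I ancient element forces a nontrivial scaling soliton of the class".
UNCONDITIONAL. Compare `typeIAncientLiouville_iff_extremalSpiralSymmetry_and_spiralScalingLiouville` (`X ↔ (ESS ∧ SSL)`,
p161077): crux 2 may be weakened from `ESS` to `SYM∃` at no cost to the route. [folklore: pure logic] -/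
theorem typeIAncientLiouville_iff_existsSymmetricElement_and_spiralScalingLiouville :
    _root_.Summit.NavierStokesRegularity.NavierStokesRegularity.Theses.ExtremalTypeIConstant.TypeIAncientLiouville ↔
      ((∀ (C : ℝ) (u : ℝ → EuclideanSpace ℝ (Fin 3) → EuclideanSpace ℝ (Fin 3)),
          IsTypeIAncientMild C u → (∃ t < 0, ∃ x, u t x ≠ 0) →
            ∃ (C' : ℝ) (w : ℝ → EuclideanSpace ℝ (Fin 3) → EuclideanSpace ℝ (Fin 3)),
              IsTypeIAncientMild C' w ∧ (∃ t < 0, ∃ x, w t x ≠ 0) ∧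
                ∃ (a : EuclideanSpace ℝ (Fin 3)) (A : EuclideanSpace ℝ (Fin 3) →L[ℝ] EuclideanSpace ℝ (Fin 3)),
                  (∀ x, inner ℝ (A x) x = 0) ∧
                    ∀ t < 0, ∀ x, fderiv ℝ (w t) x (a + x + A x) + w t x +
                      (2 * t) • Literature.Analysis.FluidPDE.timeDeriv w t x - A (w t x) = 0) ∧
        _root_.Summit.NavierStokesRegularity.NavierStokesRegularity.Theses.ExtremalTypeIConstant.SpiralScalingLiouville) :=
  ⟨fun hX => ⟨existsSymmetricElement_of_typeIAncientLiouville hX, spiralScalingLiouville_of_typeIAncientLiouville hX⟩,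
    fun h => typeIAncientLiouville_of_existsSymmetricElement_of_spiralScalingLiouville h.1 h.2⟩

/-- **Given crux 3, `SYM∃` IS the route target.** CONDITIONAL on stmt-8216 (hypothesis). [folklore: pure logic] -/
theorem existsSymmetricElement_iff_typeIAncientLiouville_of_spiralScalingLiouville (hSSL : SpiralScalingLiouville) :
    (∀ (C : ℝ) (u : ℝ → EuclideanSpace ℝ (Fin 3) → EuclideanSpace ℝ (Fin 3)),
        IsTypeIAncientMild C u → (∃ t < 0, ∃ x, u t x ≠ 0) →
          ∃ (C' : ℝ) (w : ℝ → EuclideanSpace ℝ (Fin 3) → EuclideanSpace ℝ (Fin 3)),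
            IsTypeIAncientMild C' w ∧ (∃ t < 0, ∃ x, w t x ≠ 0) ∧
              ∃ (a : EuclideanSpace ℝ (Fin 3)) (A : EuclideanSpace ℝ (Fin 3) →L[ℝ] EuclideanSpace ℝ (Fin 3)),
                (∀ x, inner ℝ (A x) x = 0) ∧
                  ∀ t < 0, ∀ x, fderiv ℝ (w t) x (a + x + A x) + w t x +
                    (2 * t) • Literature.Analysis.FluidPDE.timeDeriv w t x - A (w t x) = 0) ↔
      TypeIAncientLiouville :=
  ⟨fun hSym => typeIAncientLiouville_of_existsSymmetricElement_of_spiralScalingLiouville hSym hSSL,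
    existsSymmetricElement_of_typeIAncientLiouville⟩

/-- **The crux implies `SYM∃`, and the symmetric element may be taken extremal.** From a nontrivial element,
`MinimiserExists` (stmt-8217, proved: `extremalTypeIConstant_minimiserExists_proof`) yields an extremal pair `(C⋆, w)`
with `0 < C⋆ = ‖w(−1,0)‖`, so `w` is nontrivial, and `ExtremalSpiralSymmetry` supplies its generator. [folklore: pure
logic over arXiv:0709.3599 §6 compactness, in tree] -/
theorem existsSymmetricElement_of_extremalSpiralSymmetry (hESS : ExtremalSpiralSymmetry) :
    ∀ (C : ℝ) (u : ℝ → EuclideanSpace ℝ (Fin 3) → EuclideanSpace ℝ (Fin 3)),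
      IsTypeIAncientMild C u → (∃ t < 0, ∃ x, u t x ≠ 0) →
        ∃ (C' : ℝ) (w : ℝ → EuclideanSpace ℝ (Fin 3) → EuclideanSpace ℝ (Fin 3)),
          IsTypeIAncientMild C' w ∧ (∃ t < 0, ∃ x, w t x ≠ 0) ∧
            ∃ (a : EuclideanSpace ℝ (Fin 3)) (A : EuclideanSpace ℝ (Fin 3) →L[ℝ] EuclideanSpace ℝ (Fin 3)),
              (∀ x, inner ℝ (A x) x = 0) ∧
                ∀ t < 0, ∀ x, fderiv ℝ (w t) x (a + x + A x) + w t x +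
                  (2 * t) • Literature.Analysis.FluidPDE.timeDeriv w t x - A (w t x) = 0 := by
  intro C u hu hne
  obtain ⟨C₀, w, hC₀, hw, hnorm, hmin⟩ :=
    extremalTypeIConstant_minimiserExists_proof ⟨C, u, isTypeIAncientMild_iff.1 hu, hne⟩
  obtain ⟨a, A, hA, hgen⟩ := hESS C₀ w hC₀ ⟨hw, hnorm, hmin⟩
  refine ⟨C₀, w, isTypeIAncientMild_iff.2 hw, ⟨-1, by norm_num, 0, fun h0 => ?_⟩, a, A, hA, hgen⟩
  rw [h0, norm_zero] at hnorm
  exact hC₀.ne' hnorm.symm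

/-- **Given crux 3, the crux is EQUIVALENT to its weakest sufficient form `SYM∃`** (both are then equivalent to the
target). CONDITIONAL on stmt-8216 (hypothesis). [folklore: pure logic] -/
theorem extremalSpiralSymmetry_iff_existsSymmetricElement_of_spiralScalingLiouville (hSSL : SpiralScalingLiouville) :
    ExtremalSpiralSymmetry ↔
      (∀ (C : ℝ) (u : ℝ → EuclideanSpace ℝ (Fin 3) → EuclideanSpace ℝ (Fin 3)),
        IsTypeIAncientMild C u → (∃ t < 0, ∃ x, u t x ≠ 0) →
          ∃ (C' : ℝ) (w : ℝ → EuclideanSpace ℝ (Fin 3) → EuclideanSpace ℝ (Fin 3)),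
            IsTypeIAncientMild C' w ∧ (∃ t < 0, ∃ x, w t x ≠ 0) ∧
              ∃ (a : EuclideanSpace ℝ (Fin 3)) (A : EuclideanSpace ℝ (Fin 3) →L[ℝ] EuclideanSpace ℝ (Fin 3)),
                (∀ x, inner ℝ (A x) x = 0) ∧
                  ∀ t < 0, ∀ x, fderiv ℝ (w t) x (a + x + A x) + w t x +
                    (2 * t) • Literature.Analysis.FluidPDE.timeDeriv w t x - A (w t x) = 0) :=
  ⟨existsSymmetricElement_of_extremalSpiralSymmetry,
    fun hSym => extremalSpiralSymmetry_of_typeIAncientLiouville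
      (typeIAncientLiouville_of_existsSymmetricElement_of_spiralScalingLiouville hSym hSSL)⟩

end Summit.NavierStokesRegularity.NavierStokesRegularity.Theorems.ExtremalSpiralSymmetry.Registered
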